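/- Copyright: the b2b-balaban cell (near-miss cell 7), T⁴-continuum fan-out, lineage t4-ne7b-p1 (node U5c COUNT
member).  Released under the licence of the surrounding project. -/
import Summits.QuantumFields.BalabanUV.T4Continuum.Support.HistoryGenealogyExtractionLedger

/-!
# Genealogy extraction, part 3 (H3-(ID), combinatorial half): the ENTROPY-SIDE forest count — constituent regions of
the maximal structures against the new regions created (owner module of row NE7b, lineage `t4-ne7b-p1` gen 39, ruling
R-OWNER-39-1; re-open object (α), `SCOPE-alpha.md` v2 §5 row M3a — PRE-POSITIONING ONLY)

Summits-side support leaf of the T⁴-continuum cell (rung (B)+1 on a FINITE torus only; NOT infinite volume, NOT the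
mass gap, NOT the Clay statement; NOT a proof of the spine estimate NE7b, which is the cell's OWN estimate, NOT PRINTED
and NOT PROVED).  [folklore] finite combinatorics over parts 1–2 (`HistoryGenealogyExtraction`, `…Ledger`); nothing
printed is asserted, no `def … : Prop` fact of Bałaban's, no cite-tagged hypothesis, zero `sorry`.  B16 =
[Balaban1989LargeFieldII] is a manuscript UNDER AUDIT; p. 383's «the summations over the admissible sequences can be
replaced by the factors exp O(1)(MR_j)^{−d}|Z_j|» is quoted as CONTEXT only (the per-region entropy this bookkeeping
feeds; certified reading C-B16-6).

WHAT IS PROVED (under `WF`).  **`forest_regions_eq`** — the additive twin of part 2's `forest_evProd_eq`: the constituent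
regions of the genealogies of the components live at the cutoff `K`, plus those of every component that died at a step
`j < K`, number exactly the births booked over all levels `j ≤ K` (`Σ_j Σ_{c ∈ comp j} |news j c|`); and
**`forest_regions_le`**: that number is at most `Σ_{j ≤ K} #newReg j` — no new region is born twice across the forest of
maximal structures (part 2's `sum_length_news_le_card_newReg`, level by level); `one_le_regions_pgen` and
**`card_forest_le`**: the NUMBER OF MAXIMAL STRUCTURES (live at `K` + dead at each `j < K`) — the pedigrees an entropy
count must enumerate — is at most `Σ_{j ≤ K} #newReg j`.  This is the bookkeeping under which an entropy–energy count
may charge each pedigree's births to the step's new large-field regions once.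

HONEST.  Proves nothing of Bałaban's; BY-NAME EFFECT ON THE WALL: NONE (pre-positioning for (α)); NE7b NOT proved; spine
0∕9.  HONEST DEPENDENCY (cell): continuum YM on T⁴ ⇐ BetaPertH ∧ nine spine estimates (0/9 proved); BetaPertH ⇐ (D1) ∧
(D4) ∧ CAP+tail; G-an2-4 gates asym, D1 and NE2/3/4.  This file changes none of it.
-/

open Finset
open Literature.MathematicalPhysics.QuantumFieldTheory.Balaban1983to89

namespace Summit.QuantumFields.BalabanUV.T4Continuum.HistoryGenealogyExtraction

open HistoryAdmissible HistoryAdmissible.PGen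

namespace ComponentHistory

variable {γ : Type*} [DecidableEq γ] (H : ComponentHistory γ)

/-- **THE FOREST REGION COUNT** (under `WF`): the constituent regions of the maximal structures — live at `K`, or dead
at some `j < K` — number exactly the births booked over the levels `j ≤ K`. [folklore] -/
theorem forest_regions_eq (hW : H.WF) : ∀ K : ℕ,
    (∑ c ∈ H.comp K, (H.pgen K c).regions) + ∑ j ∈ Finset.range K, ∑ d ∈ H.died j, (H.pgen j d).regions =
      ∑ j ∈ Finset.range (K + 1), ∑ c ∈ H.comp j, (H.news j c).length
  | 0 => by
      rw [Finset.sum_range_zero, add_zero, Finset.sum_range_one]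
      refine Finset.sum_congr rfl ?_
      intro c hc
      exact H.regions_pgen_zero hW c hc
  | K + 1 => by
      have ih := forest_regions_eq hW K
      have hstep : ∑ c ∈ H.comp (K + 1), (H.pgen (K + 1) c).regions =
          (∑ c ∈ H.comp (K + 1), ((H.parts (K + 1) c).map fun p => (H.pgen K p).regions).sum) +
            ∑ c ∈ H.comp (K + 1), (H.news (K + 1) c).length := by
        rw [← Finset.sum_add_distrib]
        refine Finset.sum_congr rfl ?_
        intro c hc
        exact H.regions_pgen_succ hW K c hc
      have htel := H.sum_comp_eq_continued_add_died hW K (fun a => (H.pgen K a).regions)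
      rw [Finset.sum_range_succ _ (K + 1), Finset.sum_range_succ _ K, hstep, ← ih, htel]
      omega

/-- **NO REGION IS BORN TWICE ACROSS THE FOREST** (under `WF`): the constituent regions of all maximal structures up
to the cutoff are at most the new large-field regions created at the steps `j ≤ K`. [folklore] -/
theorem forest_regions_le (hW : H.WF) (K : ℕ) :
    (∑ c ∈ H.comp K, (H.pgen K c).regions) + ∑ j ∈ Finset.range K, ∑ d ∈ H.died j, (H.pgen j d).regions ≤
      ∑ j ∈ Finset.range (K + 1), (H.newReg j).card := by
  rw [H.forest_regions_eq hW K]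
  exact Finset.sum_le_sum fun j _ => H.sum_length_news_le_card_newReg hW j

/-- in particular (under `WF`) the live genealogies alone carry at most that many regions [folklore] -/
theorem live_regions_le (hW : H.WF) (K : ℕ) :
    (∑ c ∈ H.comp K, (H.pgen K c).regions) ≤ ∑ j ∈ Finset.range (K + 1), (H.newReg j).card :=
  (Nat.le_add_right _ _).trans (H.forest_regions_le hW K)

/-- under `WF` every extracted genealogy of a component carries at least one constituent region [folklore] -/
theorem one_le_regions_pgen (hW : H.WF) : ∀ (j : ℕ) (c : γ), c ∈ H.comp j → 1 ≤ (H.pgen j c).regions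
  | 0, c, hc => by
      rw [H.regions_pgen_zero hW c hc, ← H.length_births 0 c]
      exact List.length_pos_of_ne_nil (H.births_zero_ne_nil hW hc)
  | j + 1, c, hc => by
      rw [H.regions_pgen_succ hW j c hc]
      by_cases hn : H.news (j + 1) c = []
      · have hlen := H.length_constituents (H.pgen j) (j + 1) c
        have hne := List.length_pos_of_ne_nil (H.constituents_ne_nil hW (H.pgen j) hc)
        have hp : H.parts (j + 1) c ≠ [] := by
          intro h
          rw [h, hn] at hlen
          simp only [List.length_nil, Nat.add_zero] at hlen
          omega
        obtain ⟨p, L, hpL⟩ := List.exists_cons_of_ne_nil hp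
        have hp1 : p ∈ H.parts (j + 1) c := by simp [hpL]
        have h1 := one_le_regions_pgen hW j p (hW.parts_sub j c hc p hp1)
        rw [hpL, List.map_cons, List.sum_cons]
        omega
      · have := List.length_pos_of_ne_nil hn
        omega

/-- **THE NUMBER OF MAXIMAL STRUCTURES IS AT MOST THE NUMBER OF NEW REGIONS EVER CREATED** (under `WF`): the live
components at the cutoff `K` plus the components that died at the steps `j < K` — the pedigrees an entropy count must
enumerate — are at most `Σ_{j ≤ K} #newReg j`. [folklore] -/
theorem card_forest_le (hW : H.WF) (K : ℕ) :
    (H.comp K).card + ∑ j ∈ Finset.range K, (H.died j).card ≤ ∑ j ∈ Finset.range (K + 1), (H.newReg j).card := by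
  refine le_trans ?_ (H.forest_regions_le hW K)
  have h1 : (H.comp K).card ≤ ∑ c ∈ H.comp K, (H.pgen K c).regions := by
    rw [Finset.card_eq_sum_ones]
    exact Finset.sum_le_sum fun c hc => H.one_le_regions_pgen hW K c hc
  have h2 : ∑ j ∈ Finset.range K, (H.died j).card ≤
      ∑ j ∈ Finset.range K, ∑ d ∈ H.died j, (H.pgen j d).regions := by
    refine Finset.sum_le_sum fun j _ => ?_
    rw [Finset.card_eq_sum_ones]
    exact Finset.sum_le_sum fun d hd => H.one_le_regions_pgen hW j d (H.died_subset j hd)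
  exact Nat.add_le_add h1 h2

end ComponentHistory

/-! ## Sanity, decided: the toy of part 2 — 3 live regions at the cutoff `2`, none dead, 3 new regions created -/

namespace Sanity

/-- the toy's live genealogy at the cutoff carries 3 regions, and 3 new regions were created over the steps 0, 1, 2
[folklore] -/
example : (∑ c ∈ toy.comp 2, (toy.pgen 2 c).regions) = 3 ∧ (∑ j ∈ Finset.range 3, (toy.newReg j).card) = 3 := by
  decide

end Sanity

end Summit.QuantumFields.BalabanUV.T4Continuum.HistoryGenealogyExtraction
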